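import Literature.MathematicalPhysics.QuantumFieldTheory.Balaban1983to89.T4CauchySum

/-!
# CauchySumSummableShift — node U6's `Summable δ` from a SUMMABLE synchronised scale shift
(the TAIL VARIANT of `T4CauchySum.delta_le`; cell `pub-balaban`, T4-DAG row `T4-U6.R-QCALC2°`, ruling §8 Q43)

HONEST FRAMING (cell `pub-balaban`, page 1).  Rung (B)+1 of the FINITE-VOLUME T⁴ programme — NOT infinite volume,
NOT a mass gap, NOT the Clay problem; spine PROVED 0∕9.  This module is ELEMENTARY REAL ANALYSIS on the hypothesis
shape `T4CauchySum.delta E ρ inj K = E · Σ_{(j,n) ∈ antidiagonal K} inj K j · ρ^n` of node U6 (the Cauchy sum); it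
asserts NOTHING about Bałaban's renormalization-group objects and is NOT an estimate of any NE row.  HONEST DEPENDENCY:
continuum YM on T⁴ ⇐ BetaPertH ∧ nine spine estimates (0/9 proved); BetaPertH ⇐ (D1) ∧ (D4) ∧ CAP+tail; G-an2-4 gates
asym, D1 and NE2/3/4.

WHAT IS PROVED (the two statements typed by the calc-grammar lane as `t4/calc/QCalc2Sketch.lean`
`TailBoundHolds` ∕ `SummableDeltaOfSummableShift`, here with the predicates `SummableShift` ∕ `PinnedByShift` UNFOLDED
into binders; the by-name sockets are discharged in the companion module `CauchySumSummableShiftSocket`).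
Hypotheses: `0 ≤ E`, `0 ≤ ρ < 1`; a scale shift `shift : ℕ → ℝ` that is nonnegative, ANTITONE and SUMMABLE (e.g.
`shift k = c∕(k+1)^p`, `p > 1` — no geometric rate); an IR-pinned injection `0 ≤ inj K j ≤ Σ_{i ∈ [j, K)} shift i`
for `j ≤ K`.
* `delta_le_tail` (TAIL BOUND): `delta E ρ inj K ≤ E · ( shift(K∕2) · ρ∕(1−ρ)² + (Σ' i, shift i) · ρ^{K∕2}∕(1−ρ) )`
  (`K∕2` = natural-number division).  Proof: reindex the antidiagonal by the number `n = K − j` of remaining scales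
  and split at `n = K∕2`: for `n ≤ K∕2` every summand of `Σ_{i ∈ [K−n, K)} shift i` has `i ≥ K∕2`, so
  `inj K (K−n) ≤ n · shift(K∕2)` and `Σ_n n ρ^n ≤ ρ∕(1−ρ)²`; for `n > K∕2`, `inj ≤ Σ' shift` and
  `Σ_{n ∈ [K∕2+1, K]} ρ^n ≤ ρ^{K∕2+1}∕(1−ρ) ≤ ρ^{K∕2}∕(1−ρ)`.
* `summable_delta_of_shift`: hence `Summable (delta E ρ inj)` — WITHOUT the geometric `InjectedRate C c θ` of
  `T4CauchySum.summable_delta` (`K ↦ shift(K∕2)` and `K ↦ ρ^{K∕2}` are summable by the even∕odd split).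
LABEL OF RECORD (T4-DAG §8 Q43 (c), not re-litigated here): an ADMISSIBLE third instance of node U6's `Summable δ`
beside the geometric chain, sufficient under reading (α′) (re-evaluation with a g-Lipschitz size bound), NOT shown
sufficient under the naive crossover reading (β).  Mathlib + `T4CauchySum` only; no importer changes.
-/

namespace Summit.QuantumFields.BalabanUV.T4Continuum.CauchySumSummableShift

open Finset
open Literature.MathematicalPhysics.QuantumFieldTheory.Balaban1983to89.T4CauchySum

/-! ## §1 Reindexing the transported total by the number of remaining scales -/

/-- Reindex the antidiagonal sum of `delta` by the number `n = K − j` of remaining scales: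
`Σ_{(j,n) ∈ antidiagonal K} inj K j · ρ^n = Σ_{n < K+1} inj K (K − n) · ρ^n`. [folklore] -/
theorem sum_antidiagonal_eq_sum_remaining (inj : ℕ → ℕ → ℝ) (ρ : ℝ) (K : ℕ) :
    ∑ p ∈ antidiagonal K, inj K p.1 * ρ ^ p.2 = ∑ n ∈ range (K + 1), inj K (K - n) * ρ ^ n := by
  rw [← Nat.sum_antidiagonal_swap, Nat.sum_antidiagonal_eq_sum_range_succ_mk]
  simp only [Prod.swap_prod_mk]

/-- The transported total, reindexed: `delta E ρ inj K = E · Σ_{n < K+1} inj K (K − n) · ρ^n`. [folklore] -/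
theorem delta_eq_sum_remaining (E ρ : ℝ) (inj : ℕ → ℕ → ℝ) (K : ℕ) :
    delta E ρ inj K = E * ∑ n ∈ range (K + 1), inj K (K - n) * ρ ^ n := by
  unfold delta
  rw [sum_antidiagonal_eq_sum_remaining]

/-! ## §2 The two halves of the split at `n = K ∕ 2` -/

/-- RECENT SCALES: if the injection is pinned by an ANTITONE shift, then for `n ≤ K∕2` remaining scales
`inj K (K − n) ≤ n · shift (K∕2)` — every summand `shift i`, `i ∈ [K − n, K)`, has `i ≥ K∕2`. [folklore] -/
theorem inj_recent_le {shift : ℕ → ℝ} {inj : ℕ → ℕ → ℝ} (hanti : Antitone shift)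
    (hpin : ∀ K j : ℕ, j ≤ K → 0 ≤ inj K j ∧ inj K j ≤ ∑ i ∈ Ico j K, shift i)
    {K n : ℕ} (hn : n ≤ K / 2) : inj K (K - n) ≤ (n : ℝ) * shift (K / 2) := by
  have hnK : n ≤ K := hn.trans (Nat.div_le_self K 2)
  refine ((hpin K (K - n) (Nat.sub_le K n)).2).trans ?_
  have hcard : (Ico (K - n) K).card = n := by
    rw [Nat.card_Ico]
    omega
  calc ∑ i ∈ Ico (K - n) K, shift i ≤ ∑ i ∈ Ico (K - n) K, shift (K / 2) := by
        refine Finset.sum_le_sum fun i hi => hanti ?_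
        have := (Finset.mem_Ico.mp hi).1
        omega
    _ = (n : ℝ) * shift (K / 2) := by rw [Finset.sum_const, hcard, nsmul_eq_mul]

/-- OLD SCALES: a pinned injection never exceeds the total shift `Σ' i, shift i` (nonnegative summable
shift). [folklore] -/
theorem inj_le_tsum_shift {shift : ℕ → ℝ} {inj : ℕ → ℕ → ℝ} (h0 : ∀ k, 0 ≤ shift k)
    (hsum : Summable shift)
    (hpin : ∀ K j : ℕ, j ≤ K → 0 ≤ inj K j ∧ inj K j ≤ ∑ i ∈ Ico j K, shift i)
    {K j : ℕ} (hj : j ≤ K) : inj K j ≤ ∑' i, shift i :=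
  ((hpin K j hj).2).trans (hsum.sum_le_tsum (Ico j K) fun i _ => h0 i)

/-- RECENT HALF of the sum: `Σ_{n < K∕2+1} inj K (K − n) ρ^n ≤ shift(K∕2) · ρ∕(1−ρ)²`
(uses `Σ_n n ρ^n = ρ∕(1−ρ)²`, `hasSum_coe_mul_geometric_of_norm_lt_one`). [folklore] -/
theorem sum_recent_le {ρ : ℝ} {shift : ℕ → ℝ} {inj : ℕ → ℕ → ℝ} (hρ : 0 ≤ ρ) (hρ1 : ρ < 1)
    (h0 : ∀ k, 0 ≤ shift k) (hanti : Antitone shift)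
    (hpin : ∀ K j : ℕ, j ≤ K → 0 ≤ inj K j ∧ inj K j ≤ ∑ i ∈ Ico j K, shift i) (K : ℕ) :
    ∑ n ∈ range (K / 2 + 1), inj K (K - n) * ρ ^ n ≤ shift (K / 2) * (ρ / (1 - ρ) ^ 2) := by
  have hnorm : ‖ρ‖ < 1 := by rwa [Real.norm_eq_abs, abs_of_nonneg hρ]
  have hgeo : ∑ n ∈ range (K / 2 + 1), (n : ℝ) * ρ ^ n ≤ ρ / (1 - ρ) ^ 2 :=
    sum_le_hasSum (range (K / 2 + 1)) (fun n _ => by positivity)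
      (hasSum_coe_mul_geometric_of_norm_lt_one hnorm)
  calc ∑ n ∈ range (K / 2 + 1), inj K (K - n) * ρ ^ n
      ≤ ∑ n ∈ range (K / 2 + 1), ((n : ℝ) * shift (K / 2)) * ρ ^ n := by
        refine Finset.sum_le_sum fun n hn => ?_
        have hn' : n ≤ K / 2 := Nat.lt_succ_iff.mp (Finset.mem_range.mp hn)
        exact mul_le_mul_of_nonneg_right (inj_recent_le hanti hpin hn') (pow_nonneg hρ _)
    _ = shift (K / 2) * ∑ n ∈ range (K / 2 + 1), (n : ℝ) * ρ ^ n := by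
        rw [Finset.mul_sum]
        refine Finset.sum_congr rfl fun n _ => ?_
        ring
    _ ≤ shift (K / 2) * (ρ / (1 - ρ) ^ 2) := mul_le_mul_of_nonneg_left hgeo (h0 _)

/-- OLD HALF of the sum: `Σ_{n ∈ [K∕2+1, K+1)} inj K (K − n) ρ^n ≤ (Σ' i, shift i) · ρ^{K∕2}∕(1−ρ)`
(uses `geom_sum_Ico_le_of_lt_one` and `ρ^{K∕2+1} ≤ ρ^{K∕2}`). [folklore] -/
theorem sum_old_le {ρ : ℝ} {shift : ℕ → ℝ} {inj : ℕ → ℕ → ℝ} (hρ : 0 ≤ ρ) (hρ1 : ρ < 1)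
    (h0 : ∀ k, 0 ≤ shift k) (hsum : Summable shift)
    (hpin : ∀ K j : ℕ, j ≤ K → 0 ≤ inj K j ∧ inj K j ≤ ∑ i ∈ Ico j K, shift i) (K : ℕ) :
    ∑ n ∈ Ico (K / 2 + 1) (K + 1), inj K (K - n) * ρ ^ n
      ≤ (∑' i, shift i) * (ρ ^ (K / 2) / (1 - ρ)) := by
  have hS : 0 ≤ ∑' i, shift i := tsum_nonneg h0
  have hgeo : ∑ n ∈ Ico (K / 2 + 1) (K + 1), ρ ^ n ≤ ρ ^ (K / 2) / (1 - ρ) :=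
    (geom_sum_Ico_le_of_lt_one hρ hρ1).trans
      (div_le_div_of_nonneg_right (pow_le_pow_of_le_one hρ hρ1.le (Nat.le_succ _)) (by linarith))
  calc ∑ n ∈ Ico (K / 2 + 1) (K + 1), inj K (K - n) * ρ ^ n
      ≤ ∑ n ∈ Ico (K / 2 + 1) (K + 1), (∑' i, shift i) * ρ ^ n := by
        refine Finset.sum_le_sum fun n _ => ?_
        exact mul_le_mul_of_nonneg_right (inj_le_tsum_shift h0 hsum hpin (Nat.sub_le K n)) (pow_nonneg hρ _)
    _ = (∑' i, shift i) * ∑ n ∈ Ico (K / 2 + 1) (K + 1), ρ ^ n := by rw [Finset.mul_sum]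
    _ ≤ (∑' i, shift i) * (ρ ^ (K / 2) / (1 - ρ)) := mul_le_mul_of_nonneg_left hgeo hS

/-! ## §3 The tail bound and the summability of `delta` -/

/-- **TAIL BOUND** (= `QCalc2Sketch.DeltaTailBound E ρ shift inj` under the hypotheses of `QCalc2Sketch.TailBoundHolds`,
predicates unfolded): for `0 ≤ E`, `0 ≤ ρ < 1`, a nonnegative antitone summable shift and an injection pinned by it,
`delta E ρ inj K ≤ E · ( shift(K∕2) · ρ∕(1−ρ)² + (Σ' i, shift i) · ρ^{K∕2}∕(1−ρ) )`. [folklore] -/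
theorem delta_le_tail {E ρ : ℝ} {shift : ℕ → ℝ} {inj : ℕ → ℕ → ℝ} (hE : 0 ≤ E) (hρ : 0 ≤ ρ) (hρ1 : ρ < 1)
    (h0 : ∀ k, 0 ≤ shift k) (hanti : Antitone shift) (hsum : Summable shift)
    (hpin : ∀ K j : ℕ, j ≤ K → 0 ≤ inj K j ∧ inj K j ≤ ∑ i ∈ Ico j K, shift i) (K : ℕ) :
    delta E ρ inj K ≤
      E * (shift (K / 2) * (ρ / (1 - ρ) ^ 2) + (∑' i, shift i) * (ρ ^ (K / 2) / (1 - ρ))) := by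
  rw [delta_eq_sum_remaining, ← Finset.sum_range_add_sum_Ico _ (show K / 2 + 1 ≤ K + 1 by omega)]
  exact mul_le_mul_of_nonneg_left
    (add_le_add (sum_recent_le hρ hρ1 h0 hanti hpin K) (sum_old_le hρ hρ1 h0 hsum hpin K)) hE

/-- A pinned injection gives a nonnegative transported total (`0 ≤ E`, `0 ≤ ρ`). [folklore] -/
theorem delta_nonneg_of_pinned {E ρ : ℝ} {shift : ℕ → ℝ} {inj : ℕ → ℕ → ℝ} (hE : 0 ≤ E) (hρ : 0 ≤ ρ)
    (hpin : ∀ K j : ℕ, j ≤ K → 0 ≤ inj K j ∧ inj K j ≤ ∑ i ∈ Ico j K, shift i) (K : ℕ) :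
    0 ≤ delta E ρ inj K := by
  unfold delta
  refine mul_nonneg hE (Finset.sum_nonneg fun p hp => ?_)
  have hj : p.1 ≤ K := by have := mem_antidiagonal.mp hp; omega
  exact mul_nonneg (hpin K p.1 hj).1 (pow_nonneg hρ _)

/-- `K ↦ f (K∕2)` is summable when `f` is (even∕odd split: both subsequences are `f` itself). [folklore] -/
theorem summable_comp_half {f : ℕ → ℝ} (hf : Summable f) : Summable (fun K : ℕ => f (K / 2)) := by
  have he : (fun k : ℕ => f (2 * k / 2)) = f := by
    funext k
    congr 1
    omega
  have ho : (fun k : ℕ => f ((2 * k + 1) / 2)) = f := by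
    funext k
    congr 1
    omega
  refine Summable.even_add_odd ?_ ?_
  · rw [he]; exact hf
  · rw [ho]; exact hf

/-- **Σ_K δ_K < ∞ WITHOUT a geometric injected rate** (= `QCalc2Sketch.SummableDeltaOfSummableShift`, predicates
unfolded): for `0 ≤ E`, `0 ≤ ρ < 1`, a nonnegative antitone summable shift and an injection pinned by it,
`Summable (delta E ρ inj)`. [folklore] -/
theorem summable_delta_of_shift {E ρ : ℝ} {shift : ℕ → ℝ} {inj : ℕ → ℕ → ℝ} (hE : 0 ≤ E) (hρ : 0 ≤ ρ)
    (hρ1 : ρ < 1) (h0 : ∀ k, 0 ≤ shift k) (hanti : Antitone shift) (hsum : Summable shift)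
    (hpin : ∀ K j : ℕ, j ≤ K → 0 ≤ inj K j ∧ inj K j ≤ ∑ i ∈ Ico j K, shift i) :
    Summable (delta E ρ inj) := by
  have h1 : Summable (fun K : ℕ => shift (K / 2) * (ρ / (1 - ρ) ^ 2)) :=
    (summable_comp_half hsum).mul_right _
  have h2 : Summable (fun K : ℕ => (∑' i, shift i) * (ρ ^ (K / 2) / (1 - ρ))) :=
    ((summable_comp_half (summable_geometric_of_lt_one hρ hρ1)).div_const (1 - ρ)).mul_left _
  have hmaj : Summable (fun K : ℕ =>
      E * (shift (K / 2) * (ρ / (1 - ρ) ^ 2) + (∑' i, shift i) * (ρ ^ (K / 2) / (1 - ρ)))) :=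
    (h1.add h2).mul_left E
  exact Summable.of_nonneg_of_le (fun K => delta_nonneg_of_pinned hE hρ hpin K)
    (fun K => delta_le_tail hE hρ hρ1 h0 hanti hsum hpin K) hmaj

/-! ## §4 Node U6 assembled on the summable-shift instance; non-vacuity of the hypothesis class -/

/-- **Node U6 (THE CAUCHY SUM) on the SUMMABLE-SHIFT instance** — the sibling of `T4CauchySum.cauchySum` with the
geometric `InjectedRate C c θ inj` REPLACED by a nonnegative antitone summable scale shift pinning the injection:
the transported totals are summable, consecutive generating functions differ by at most `2·vol·δ_K` on `|t| ≤ l₀`,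
every `K ↦ genFun Z K t` is Cauchy, and the convergence to `genFunLim Z` is uniform on the closed l₀-ball.  A
CONDITIONAL kernel theorem over hypothesis shapes; none of its hypotheses is in print for Bałaban's d = 4 procedure;
admissible at node U6 under reading (α′) only (T4-DAG §8 Q43 (c)). [folklore] -/
theorem cauchySum_of_shift {ρ E vol l₀ : ℝ} {shift : ℕ → ℝ} {inj : ℕ → ℕ → ℝ} {Z : ℕ → ℝ → ℝ}
    (hE : 0 ≤ E) (hρ : 0 ≤ ρ) (hρ1 : ρ < 1) (h0 : ∀ k, 0 ≤ shift k) (hanti : Antitone shift)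
    (hsum : Summable shift) (hpin : ∀ K j : ℕ, j ≤ K → 0 ≤ inj K j ∧ inj K j ≤ ∑ i ∈ Ico j K, shift i)
    (hl₀ : 0 ≤ l₀) (hU5 : MatchingModConstants vol l₀ (delta E ρ inj) Z) :
    Summable (delta E ρ inj) ∧
    (∀ K : ℕ, ∀ t : ℝ, |t| ≤ l₀ → |genFun Z (K + 1) t - genFun Z K t| ≤ 2 * (vol * delta E ρ inj K)) ∧
    (∀ t : ℝ, |t| ≤ l₀ → CauchySeq fun K => genFun Z K t) ∧
    TendstoUniformlyOn (fun K t => genFun Z K t) (genFunLim Z) Filter.atTop {t | |t| ≤ l₀} := by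
  have hδ : Summable (delta E ρ inj) := summable_delta_of_shift hE hρ hρ1 h0 hanti hsum hpin
  exact ⟨hδ, fun K t ht => abs_genFun_succ_sub_le hU5 hl₀ K ht, fun t ht => cauchySeq_genFun hU5 hl₀ hδ ht,
    tendstoUniformlyOn_genFun hU5 hl₀ hδ⟩

/-- NON-VACUITY of the shift class WITHOUT a geometric rate: `shift k = c∕(k+1)²` (`c ≥ 0`) is nonnegative, antitone
and summable (the HARM-2 ∕ memory-induced `1∕k²` class of the calc-grammar lane, GRAMMAR §3.1). [folklore] -/
theorem shift_inv_sq_admissible {c : ℝ} (hc : 0 ≤ c) :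
    (∀ k : ℕ, 0 ≤ c / ((k : ℝ) + 1) ^ 2) ∧ Antitone (fun k : ℕ => c / ((k : ℝ) + 1) ^ 2) ∧
      Summable (fun k : ℕ => c / ((k : ℝ) + 1) ^ 2) := by
  refine ⟨fun k => by positivity, fun k m hkm => ?_, ?_⟩
  · have hk : (0 : ℝ) < ((k : ℝ) + 1) ^ 2 := by positivity
    have hkm' : ((k : ℝ) + 1) ^ 2 ≤ ((m : ℝ) + 1) ^ 2 := by
      have : (k : ℝ) ≤ m := by exact_mod_cast hkm
      nlinarith
    exact div_le_div_of_nonneg_left hc hk hkm'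
  · have h : Summable (fun n : ℕ => 1 / ((n : ℝ)) ^ 2) := Real.summable_one_div_nat_pow.mpr one_lt_two
    have h1 := ((summable_nat_add_iff 1).mpr h).mul_left c
    refine h1.congr fun k => ?_
    push_cast
    ring

/-! ## §5 The «summable shift + polynomial sup» form of ruling Q43 (c) -/

/-- TAIL BOUND, two-sequence form (the shape of the relayed derivation Q-calc-2: `M K` bounds the RECENT injections
per remaining scale, `D K` bounds ALL injections of run `K`): if `inj K (K − n) ≤ n · M K` for `n ≤ K∕2` and
`0 ≤ inj K j ≤ D K` for `j ≤ K`, then `delta E ρ inj K ≤ E · ( M K · ρ∕(1−ρ)² + D K · ρ^{K∕2}∕(1−ρ) )`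
(`0 ≤ E`, `0 ≤ ρ < 1`, `0 ≤ M K`). [folklore] -/
theorem delta_le_tail_sup {E ρ : ℝ} {M D : ℕ → ℝ} {inj : ℕ → ℕ → ℝ} (hE : 0 ≤ E) (hρ : 0 ≤ ρ) (hρ1 : ρ < 1)
    (hM : ∀ K, 0 ≤ M K) (hrecent : ∀ K n : ℕ, n ≤ K / 2 → inj K (K - n) ≤ (n : ℝ) * M K)
    (hsup : ∀ K j : ℕ, j ≤ K → 0 ≤ inj K j ∧ inj K j ≤ D K) (K : ℕ) :
    delta E ρ inj K ≤ E * (M K * (ρ / (1 - ρ) ^ 2) + D K * (ρ ^ (K / 2) / (1 - ρ))) := by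
  have hnorm : ‖ρ‖ < 1 := by rwa [Real.norm_eq_abs, abs_of_nonneg hρ]
  have hD : 0 ≤ D K := (hsup K K le_rfl).1.trans (hsup K K le_rfl).2
  have hgeo1 : ∑ n ∈ range (K / 2 + 1), (n : ℝ) * ρ ^ n ≤ ρ / (1 - ρ) ^ 2 :=
    sum_le_hasSum (range (K / 2 + 1)) (fun n _ => by positivity)
      (hasSum_coe_mul_geometric_of_norm_lt_one hnorm)
  have hgeo2 : ∑ n ∈ Ico (K / 2 + 1) (K + 1), ρ ^ n ≤ ρ ^ (K / 2) / (1 - ρ) :=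
    (geom_sum_Ico_le_of_lt_one hρ hρ1).trans
      (div_le_div_of_nonneg_right (pow_le_pow_of_le_one hρ hρ1.le (Nat.le_succ _)) (by linarith))
  have hA : ∑ n ∈ range (K / 2 + 1), inj K (K - n) * ρ ^ n ≤ M K * (ρ / (1 - ρ) ^ 2) := by
    calc ∑ n ∈ range (K / 2 + 1), inj K (K - n) * ρ ^ n
        ≤ ∑ n ∈ range (K / 2 + 1), ((n : ℝ) * M K) * ρ ^ n := by
          refine Finset.sum_le_sum fun n hn => ?_
          have hn' : n ≤ K / 2 := Nat.lt_succ_iff.mp (Finset.mem_range.mp hn)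
          exact mul_le_mul_of_nonneg_right (hrecent K n hn') (pow_nonneg hρ _)
      _ = M K * ∑ n ∈ range (K / 2 + 1), (n : ℝ) * ρ ^ n := by
          rw [Finset.mul_sum]
          refine Finset.sum_congr rfl fun n _ => ?_
          ring
      _ ≤ M K * (ρ / (1 - ρ) ^ 2) := mul_le_mul_of_nonneg_left hgeo1 (hM K)
  have hB : ∑ n ∈ Ico (K / 2 + 1) (K + 1), inj K (K - n) * ρ ^ n ≤ D K * (ρ ^ (K / 2) / (1 - ρ)) := by
    calc ∑ n ∈ Ico (K / 2 + 1) (K + 1), inj K (K - n) * ρ ^ n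
        ≤ ∑ n ∈ Ico (K / 2 + 1) (K + 1), D K * ρ ^ n := by
          refine Finset.sum_le_sum fun n _ => ?_
          exact mul_le_mul_of_nonneg_right (hsup K (K - n) (Nat.sub_le K n)).2 (pow_nonneg hρ _)
      _ = D K * ∑ n ∈ Ico (K / 2 + 1) (K + 1), ρ ^ n := by rw [Finset.mul_sum]
      _ ≤ D K * (ρ ^ (K / 2) / (1 - ρ)) := mul_le_mul_of_nonneg_left hgeo2 hD
  rw [delta_eq_sum_remaining, ← Finset.sum_range_add_sum_Ico _ (show K / 2 + 1 ≤ K + 1 by omega)]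
  exact mul_le_mul_of_nonneg_left (add_le_add hA hB) hE

/-- Polynomial times `ρ^{K∕2}` is summable: `Σ_K (K+1)^q ρ^{K∕2} < ∞` for `0 ≤ ρ < 1` (even∕odd split onto
`T4CauchySum.summable_succ_pow_mul_geometric`). [folklore] -/
theorem summable_succ_pow_mul_pow_half {ρ : ℝ} (hρ : 0 ≤ ρ) (hρ1 : ρ < 1) (q : ℕ) :
    Summable (fun K : ℕ => ((K : ℝ) + 1) ^ q * ρ ^ (K / 2)) := by
  have hg : Summable (fun k : ℕ => (2 : ℝ) ^ q * (((k : ℝ) + 1) ^ q * ρ ^ k)) :=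
    (summable_succ_pow_mul_geometric hρ hρ1 q).mul_left _
  have hdom : ∀ k : ℕ, ∀ r : ℝ, 0 ≤ r → r ≤ 2 * ((k : ℝ) + 1) →
      r ^ q * ρ ^ k ≤ (2 : ℝ) ^ q * (((k : ℝ) + 1) ^ q * ρ ^ k) := by
    intro k r hr0 hr
    calc r ^ q * ρ ^ k ≤ (2 * ((k : ℝ) + 1)) ^ q * ρ ^ k :=
          mul_le_mul_of_nonneg_right (pow_le_pow_left₀ hr0 hr q) (pow_nonneg hρ k)
      _ = (2 : ℝ) ^ q * (((k : ℝ) + 1) ^ q * ρ ^ k) := by rw [mul_pow]; ring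
  refine Summable.even_add_odd ?_ ?_
  · have e : ∀ k : ℕ, 2 * k / 2 = k := fun k => by omega
    refine Summable.of_nonneg_of_le (fun k => by positivity) (fun k => ?_) hg
    simp only [e, Nat.cast_mul, Nat.cast_ofNat]
    exact hdom k _ (by positivity) (by linarith)
  · have e : ∀ k : ℕ, (2 * k + 1) / 2 = k := fun k => by omega
    refine Summable.of_nonneg_of_le (fun k => by positivity) (fun k => ?_) hg
    simp only [e, Nat.cast_add, Nat.cast_mul, Nat.cast_ofNat, Nat.cast_one]
    exact hdom k _ (by positivity) (by linarith)

/-- **Σ_K δ_K < ∞ from a summable recent-scale bound `M` and a sup bound `D` with `Σ_K D K ρ^{K∕2} < ∞`** (e.g. `D`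
polynomial, by `summable_succ_pow_mul_pow_half`) — the «summable shift + polynomial sup» form of T4-DAG §8 Q43 (c).
[folklore] -/
theorem summable_delta_of_tail_sup {E ρ : ℝ} {M D : ℕ → ℝ} {inj : ℕ → ℕ → ℝ} (hE : 0 ≤ E) (hρ : 0 ≤ ρ)
    (hρ1 : ρ < 1) (hM : ∀ K, 0 ≤ M K) (hMs : Summable M)
    (hDs : Summable (fun K : ℕ => D K * ρ ^ (K / 2)))
    (hrecent : ∀ K n : ℕ, n ≤ K / 2 → inj K (K - n) ≤ (n : ℝ) * M K)
    (hsup : ∀ K j : ℕ, j ≤ K → 0 ≤ inj K j ∧ inj K j ≤ D K) : Summable (delta E ρ inj) := by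
  have hmaj : Summable (fun K : ℕ => E * (M K * (ρ / (1 - ρ) ^ 2) + D K * (ρ ^ (K / 2) / (1 - ρ)))) := by
    have h2 : Summable (fun K : ℕ => D K * (ρ ^ (K / 2) / (1 - ρ))) :=
      (hDs.div_const (1 - ρ)).congr fun K => by ring
    exact ((hMs.mul_right _).add h2).mul_left E
  refine Summable.of_nonneg_of_le (fun K => ?_) (fun K => delta_le_tail_sup hE hρ hρ1 hM hrecent hsup K) hmaj
  unfold delta
  refine mul_nonneg hE (Finset.sum_nonneg fun p hp => ?_)
  have hj : p.1 ≤ K := by have := mem_antidiagonal.mp hp; omega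
  exact mul_nonneg (hsup K p.1 hj).1 (pow_nonneg hρ _)

/-- POLYNOMIAL-SUP COROLLARY: a summable nonnegative recent-scale bound `M` and `0 ≤ inj K j ≤ C·(K+1)^q` give
`Σ_K δ_K < ∞` (`0 ≤ E`, `0 ≤ ρ < 1`). [folklore] -/
theorem summable_delta_of_tail_polySup {E ρ C : ℝ} {q : ℕ} {M : ℕ → ℝ} {inj : ℕ → ℕ → ℝ} (hE : 0 ≤ E)
    (hρ : 0 ≤ ρ) (hρ1 : ρ < 1) (hM : ∀ K, 0 ≤ M K) (hMs : Summable M)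
    (hrecent : ∀ K n : ℕ, n ≤ K / 2 → inj K (K - n) ≤ (n : ℝ) * M K)
    (hsup : ∀ K j : ℕ, j ≤ K → 0 ≤ inj K j ∧ inj K j ≤ C * ((K : ℝ) + 1) ^ q) :
    Summable (delta E ρ inj) := by
  refine summable_delta_of_tail_sup (D := fun K => C * ((K : ℝ) + 1) ^ q) hE hρ hρ1 hM hMs ?_ hrecent hsup
  have := (summable_succ_pow_mul_pow_half hρ hρ1 q).mul_left C
  exact this.congr fun K => by ring

end Summit.QuantumFields.BalabanUV.T4Continuum.CauchySumSummableShift
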